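import Summits.AtomisticToContinuum.FouriersLaw.Theorems.BondHeatUncertaintyBoundedResponseBathHeatKickProfile
import HarnessLib

/-!
# BondHeatUncertainty / BoundedResponse — «HeatReturn»: the LATE CUMULATIVE HEAT-RETURN CURVE beneath 11071
(decomp-a2c lens-1 «grading / quantitative ladder», g111, NODE 111 «CumulativeResponse / HeatReturn»; blocker item stmt-AtomisticToContinuum-11071 =
`BoundedResponse`; part 1 of 3: §1–§2 here, §3–§4 `…BathHeatHeatReturnB`, §5 `…BathHeatHeatReturn` (main))

THE QUESTION OF RECORD (POINTERS-g111 items 0–2; NODE-g110 §2 «why the rungs might fail: ECHO TIMING»).  Beneath the blocker the door of record is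
`11071 ⟺ (S) ∧ LateTailFloor a 1 1` (NODE 109), `LateTailFloor a 1 g ∋ B^late_N(aN, cN²) ≥ −C N^g`, `B^late_N(s,t) = γ² ∫_{(0,∞)} ℓ_{s,t}(u) K_N(u) du`
(`ℓ_{s,t} = lateWeight`, `≡ 0` on `u ≤ s`, `0 ≤ ℓ ≤ t` for `2s ≤ t`).  NODE 110 typed the boundary kernel PER LAG as a 1-D thermal integral
`K_N(u) = ∫ (k² − T)·Ḡ_{N,u}(k) dν_T(k)` of the ENERGY RESPONSE CURVE `Ḡ_{N,u}(k) = ∫ (P_u p₀²)(q, p[0 ↦ k]) dμ_T` (`kinKickProfile`, the census KICK curve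
`ĝ_u(k)`) and hung the rungs (ER∪/ER↑/ERᶠ): «EVERY late curve `Ḡ_{N,u}`, `u ≥ aN`, is convex / nondecreasing in the injected energy».  Their standing failure
mode is ECHO TIMING: a harder kick may return its heat to the boundary EARLIER or LATER, so that at a FIXED lag `u` the response need not be monotone in `k`
even when the total late return is.

ANSWER TYPED HERE — INTEGRATE IN TIME BEFORE IMPOSING SHAPE (lens «grading» applied to the ORDER OF INTEGRATION).  Objects (§2):
  `U^{s,t}_N(z) := ∫_{(0,∞)} ℓ_{s,t}(u)·v_u(z) du` (`lateCumFcast`; `v_u = P_u(p₀² − T) = kinAct`) — the late-weighted CUMULATIVE excess-heat forecast of a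
  microstate, and its kick profile, the HEAT-RETURN CURVE `𝔊^{s,t}_N(k) := ∫ U^{s,t}_N(q, p[0 ↦ k]) dμ_T` (`heatReturnProfile`).  Proved:
  ★ `B^late_N(s,t) = γ² ∫ (p₀² − T)·U^{s,t}_N dμ_T = γ² ∫ (k² − T)·𝔊^{s,t}_N(k) dν_T(k)` (§3, `bathTailLate_eq_integral_kinObs_mul_lateCumFcast`,
    `bathTailLate_eq_integral_heatReturnProfile`; one weighted Fubini lemma §1 + NODE 110's resampling Stein identity) — the late functional of NODE 109 is
    the thermal integral of ONE curve, not of a one-parameter family of curves;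
  ★ THE HEAT-RETURN DOOR `B^late_N(s,t) ≥ −γ²·𝔇_T(𝔊^{s,t}_N)` (§3, `bathTailLate_ge_neg_heatReturnDefect`; `𝔇_T` = NODE 110 `thermalCrossDefect`), hence
    `B^late ≥ 0` whenever `𝔊` is a.e. nondecreasing in `k²` or a.e. convex (`bathTailLate_nonneg_of_monotoneSq`, `…_of_convexOn`; `𝔊` is EVEN, `heatReturnProfile_neg`);
    the same door for the WHOLE bath tail (`s = 0`: `B_N(t) ≥ −γ²𝔇_T(𝔊^{0,t}_N)`, `bathTail_ge_neg_heatReturnDefect`);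
  ★ `𝔊^{s,t}_N(k) = ∫_{(0,∞)} ℓ_{s,t}(u)·(Ḡ_{N,u}(k) − T) du = ∫_{(s,∞)} …` for EVERY `k` (§4, `heatReturnProfile_eq_setIntegral`, `…_Ioi`: the curve is
    the ℓ-weighted time integral of NODE 110's curves and is BLIND to every lag `u ≤ s`), and the COMPARISON `heatReturnProfile_mono_of_kinKickProfile_mono`:
    pointwise energy-monotonicity of every `Ḡ_{N,u}`, `u > s`, implies energy-monotonicity of `𝔊^{s,t}_N` (`2s ≤ t`) — never conversely: (HR↑) asks only
    that a harder kick return MORE late-time-weighted heat IN TOTAL, not at every single lag.  Echo timing is integrated out.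
§5 hangs the rungs `LateHeatReturnConvex a ⟹ LateHeatReturnMonotone a ⟹ LateHeatReturnFloor a g (every g, constant 0) ⟹ LateTailFloor a 1 g ⟹ (g ≤ 1, with
(S)) 11071` (`heatReturnLadder`, every arrow proved) and `LateHeatReturnMonotone a ⟸ pointwise (ER↑) past the window` (`lateHeatReturnMonotone_of_kinKickProfile_mono`).

TAGS.  (HR∪_a), (HR↑_a), (HRᶠ_{a,g}) are route statements of this cell: UNDECIDED · INSTRUMENTABLE (KICK-111 = the ℓ_{aN,cN²}-weighted time sum of the
KICK-110 excess profiles `ĝ_u(k) − T`, one curve per `N`) · at `g = 1` jointly with (S) equivalent-in-strength to nothing weaker than the door.  Remaining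
failure mode (NOT echo timing): HARD-KICK SATURATION — a kick with `k² ≫ T` is partly drained straight into the bath by the boundary friction before the
chain stores it, so `𝔊(k)` may flatten or dip at large `|k|`; that region is Gaussian-cheap and is exactly what the graded defect (HRᶠ_{a,g}) budgets.
PHONON CALIBRATION is claimed at DOOR level only (`lam = β = 0`: `B^late ≥ 0` is NODE 109/110's calibration); the curve `𝔊` itself is typed through the
anharmonic Harris package (`β > 0`), so no `β = 0` statement about `𝔊` is made here (Bochner junk otherwise).

References: the model [cite: Aoki–Kusnezov 2000; Lepri–Livi–Politi 2003]; Stein / Gaussian resampling and Fubini are folklore; the Harris/Lyapunov package is the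
tree's (`harrisBound_exists`).  Every `theorem` is kernel-checked from the imported tree; NO literature fact is introduced; the three `def … : Prop` of §5 are
route statements of this cell.  No `sorry`, no new axioms.
-/

noncomputable section

open MeasureTheory ProbabilityTheory Filter Topology Set Function
open scoped NNReal ENNReal
open Literature.MathematicalPhysics.KineticTheory.HeatConduction
open Literature.MathematicalPhysics.KineticTheory OscillatorChain
open Literature.Probability.Process
open Summit.AtomisticToContinuum.FouriersLaw.Theorems.OddSectorIrreversibility
  (pinnedChain_stronglyMeasurable_act_uncurry pinnedChain_integral_sq_act_le_of_stronglyMeasurable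
    pinnedChain_integrable_transitionKernel_of_abs_le integral_exp_neg_mul_Ioi' integrable_mul_of_integrable_sq)
open Summit.AtomisticToContinuum.FouriersLaw.Theorems.BoundedResponse.ParityFloor
  (kinObs kinAct continuous_kinObs abs_kinObs_le stronglyMeasurable_kinAct abs_kinAct_le kinAct_integrableOn
    harrisBound_exists weight_facts kinObs_sq_facts)

namespace Summit.AtomisticToContinuum.FouriersLaw.Theorems.BoundedResponse.HeatSpreading

/-! ## §1 Fubini with a BOUNDED TIME WEIGHT and the decaying dominant -/

section WeightedFubini

variable {N : ℕ} {ω₂ lam β γ T : ℝ}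

/-- **Weighted Fubini with the decaying dominant.**  For a finite measure `ν` integrating `e^{2ϑH}`, a strongly measurable `F`
with `F² ∈ L¹(ν)`, and a measurable time weight `w` bounded on `(0,∞)`:
`∫ F(z)·(∫_{(0,∞)} w(u) v_u(z) du) dν = ∫_{(0,∞)} w(u)·(∫ F v_u dν) du` (`v_u = P_u θ_b = kinAct`) — domination
`|F||w||v_u| ≤ W·K(2/ϑ+T)·(F² + e^{2ϑH})/2·e^{−cu⁺}` (the tree's `integral_mul_setIntegral_kinAct` is the case `w ≡ 1`). [folklore] -/
theorem integral_mul_setIntegral_weight_kinAct (hω : 0 < ω₂) (hl : 0 ≤ lam) (hβ : 0 ≤ β) (hγ : 0 ≤ γ) (hT : 0 < T)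
    {ϑ K c : ℝ} (hϑ0 : 0 < ϑ) (hK : 0 ≤ K) (hb : ∀ (z : PhaseSpace N) (t : ℝ≥0) (f : PhaseSpace N → ℝ), Continuous f → ∀ C : ℝ, 0 ≤ C →
      (∀ y, |f y| ≤ C * Real.exp (ϑ * (pinnedChain ω₂ lam β γ).hamiltonian N y)) →
      |(∫ y, f y ∂((pinnedChain ω₂ lam β γ).transitionKernel N T T t z)) -
          ∫ y, f y ∂((pinnedChain ω₂ lam β γ).gibbsMeasure N T)| ≤
        K * C * Real.exp (ϑ * (pinnedChain ω₂ lam β γ).hamiltonian N z) * Real.exp (-c * t)) (hc : 0 < c) (b : Fin N)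
    (ν : Measure (PhaseSpace N)) [IsFiniteMeasure ν]
    (hν : Integrable (fun y => Real.exp (2 * ϑ * (pinnedChain ω₂ lam β γ).hamiltonian N y)) ν)
    {F : PhaseSpace N → ℝ} (hFm : StronglyMeasurable F) (hF2 : Integrable (fun z => F z ^ 2) ν)
    {w : ℝ → ℝ} (hwm : Measurable w) {W : ℝ} (hW : ∀ u : ℝ, 0 < u → |w u| ≤ W) :
    ∫ z, F z * (∫ u in Ioi (0 : ℝ), w u * kinAct ω₂ lam β γ T N b u z) ∂ν =
      ∫ u in Ioi (0 : ℝ), w u * ∫ z, F z * kinAct ω₂ lam β γ T N b u z ∂ν := by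
  set P := pinnedChain ω₂ lam β γ with hP
  have hW0 : 0 ≤ W := (abs_nonneg _).trans (hW 1 one_pos)
  -- truncated weight, bounded everywhere
  set w' : ℝ → ℝ := (Ioi (0 : ℝ)).indicator w with hw'
  have hw'm : Measurable w' := hwm.indicator measurableSet_Ioi
  have hW' : ∀ u, |w' u| ≤ W := fun u => by
    by_cases hu : u ∈ Ioi (0 : ℝ)
    · rw [hw', indicator_of_mem hu]; exact hW u hu
    · rw [hw', indicator_of_notMem hu, abs_zero]; exact hW0
  have hww' : ∀ u ∈ Ioi (0 : ℝ), w u = w' u := fun u hu => by rw [hw', indicator_of_mem hu]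
  -- the weight `W e^{-c u⁺}` is integrable on `(0,∞)`
  have hw2 : IntegrableOn (fun t : ℝ => W * Real.exp (-c * (t.toNNReal : ℝ))) (Ioi 0) :=
    ((exp_neg_integrableOn_Ioi 0 hc).congr_fun (fun t ht => by
      rw [Real.coe_toNNReal _ (le_of_lt (show (0 : ℝ) < t from ht))]) measurableSet_Ioi).const_mul W
  -- joint measurability of `(z, u) ↦ F z * (w' u * v_u z)`
  have hjm : AEStronglyMeasurable (uncurry fun z u => F z * (w' u * kinAct ω₂ lam β γ T N b u z))
      (ν.prod (volume.restrict (Ioi (0 : ℝ)))) := by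
    have h1 := (pinnedChain_stronglyMeasurable_act_uncurry hω hl hβ hγ T T (N := N)
      (continuous_kinObs T b).measurable).comp_measurable
      (measurable_swap : Measurable fun q : PhaseSpace N × ℝ => q.swap)
    have h2 : StronglyMeasurable fun q : PhaseSpace N × ℝ => F q.1 := hFm.comp_measurable measurable_fst
    have h3 : StronglyMeasurable fun q : PhaseSpace N × ℝ => w' q.2 := (hw'm.comp measurable_snd).stronglyMeasurable
    exact (h2.mul (h3.mul h1)).aestronglyMeasurable
  -- the dominating product
  have hwint : Integrable (fun z => K * (2 / ϑ + T) * ((F z ^ 2 + Real.exp (2 * ϑ * P.hamiltonian N z)) / 2)) ν :=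
    ((hF2.add hν).div_const 2).const_mul _
  have hKC : 0 ≤ K * (2 / ϑ + T) := by positivity
  have hprod : Integrable (uncurry fun z u => F z * (w' u * kinAct ω₂ lam β γ T N b u z))
      (ν.prod (volume.restrict (Ioi (0 : ℝ)))) := by
    refine Integrable.mono' (hwint.mul_prod hw2) hjm (Eventually.of_forall fun q => ?_)
    rcases q with ⟨z, t⟩
    simp only [uncurry]
    rw [norm_mul, norm_mul, Real.norm_eq_abs, Real.norm_eq_abs, Real.norm_eq_abs]
    have h1 := abs_kinAct_le hω hl hβ hT hϑ0 hb b t z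
    have hE : Real.exp (ϑ * P.hamiltonian N z) ^ 2 = Real.exp (2 * ϑ * P.hamiltonian N z) := by
      rw [← Real.exp_nat_mul]; ring_nf
    have hAM : |F z| * Real.exp (ϑ * P.hamiltonian N z) ≤ (F z ^ 2 + Real.exp (2 * ϑ * P.hamiltonian N z)) / 2 := by
      rw [← hE]
      nlinarith [sq_nonneg (|F z| - Real.exp (ϑ * P.hamiltonian N z)), sq_abs (F z)]
    have hw0 : 0 ≤ Real.exp (-c * ((t.toNNReal : ℝ≥0) : ℝ)) := (Real.exp_pos _).le
    calc |F z| * (|w' t| * |kinAct ω₂ lam β γ T N b t z|)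
        ≤ |F z| * (W * (K * (2 / ϑ + T) * Real.exp (ϑ * P.hamiltonian N z) * Real.exp (-c * (t.toNNReal : ℝ)))) := by
          gcongr
          exact hW' t
      _ = K * (2 / ϑ + T) * (|F z| * Real.exp (ϑ * P.hamiltonian N z)) * (W * Real.exp (-c * (t.toNNReal : ℝ))) := by ring
      _ ≤ K * (2 / ϑ + T) * ((F z ^ 2 + Real.exp (2 * ϑ * P.hamiltonian N z)) / 2) *
            (W * Real.exp (-c * (t.toNNReal : ℝ))) := by gcongr
  -- replace `w` by `w'` on both sides, then swap
  have hL : ∀ z, (∫ u in Ioi (0 : ℝ), w u * kinAct ω₂ lam β γ T N b u z) =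
      ∫ u in Ioi (0 : ℝ), w' u * kinAct ω₂ lam β γ T N b u z := fun z =>
    setIntegral_congr_fun measurableSet_Ioi (fun u hu => by rw [hww' u hu])
  have hR : (∫ u in Ioi (0 : ℝ), w u * ∫ z, F z * kinAct ω₂ lam β γ T N b u z ∂ν) =
      ∫ u in Ioi (0 : ℝ), w' u * ∫ z, F z * kinAct ω₂ lam β γ T N b u z ∂ν :=
    setIntegral_congr_fun measurableSet_Ioi (fun u hu => by rw [hww' u hu])
  simp_rw [hL]
  rw [hR]
  have h1 : ∫ z, F z * (∫ u in Ioi (0 : ℝ), w' u * kinAct ω₂ lam β γ T N b u z) ∂ν =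
      ∫ z, (∫ u in Ioi (0 : ℝ), F z * (w' u * kinAct ω₂ lam β γ T N b u z)) ∂ν := by
    refine integral_congr_ae (Eventually.of_forall fun z => ?_)
    dsimp only
    rw [integral_const_mul]
  rw [h1, integral_integral_swap hprod]
  refine setIntegral_congr_fun measurableSet_Ioi (fun u _ => ?_)
  rw [← integral_const_mul]
  refine integral_congr_ae (Eventually.of_forall fun z => ?_)
  beta_reduce
  ring

end WeightedFubini

/-! ## §2 Objects: the late cumulative forecast `U^{s,t}_N` and the HEAT-RETURN CURVE `𝔊^{s,t}_N` -/

/-- **Late cumulative forecast** `U^{s,t}_N(z) := ∫_{(0,∞)} ℓ_{s,t}(u)·(P_u θ₀)(z) du` (`θ₀ = p₀² − T`, `ℓ_{s,t}` the late weight of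
NODE 109, `0` for `N = 0`): the late-time-weighted total excess boundary kinetic energy FORECAST from the microstate `z`. [new] -/
def lateCumFcast (ω₂ lam β γ T : ℝ) (N : ℕ) (s t : ℝ) (z : PhaseSpace N) : ℝ :=
  if h : 0 < N then ∫ u in Ioi (0 : ℝ), lateWeight s t u * kinAct ω₂ lam β γ T N ⟨0, h⟩ u z else 0

/-- **HEAT-RETURN CURVE `𝔊^{s,t}_N(k) := ∫ U^{s,t}_N(q, p[0 ↦ k]) dμ_T`** — the late-time-weighted cumulative excess boundary kinetic
energy after the bath particle's momentum has been SET to `k` in an equilibrium configuration (`N ≥ 1`; `0` for `N = 0`).  Census name: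
the ℓ-weighted time sum of the KICK profile `ĝ_u(k) − T`. [new] -/
def heatReturnProfile (ω₂ lam β γ T : ℝ) (N : ℕ) (s t k : ℝ) : ℝ :=
  if h : 0 < N then
    ∫ z, lateCumFcast ω₂ lam β γ T N s t ((z.1, Function.update z.2 ⟨0, h⟩ k) : PhaseSpace N)
      ∂((pinnedChain ω₂ lam β γ).gibbsMeasure N T)
  else 0

/-- `U^{s,t}_{n+1}` unfolded. [formal bookkeeping] -/
theorem lateCumFcast_succ (ω₂ lam β γ T : ℝ) (n : ℕ) (s t : ℝ) (z : PhaseSpace (n + 1)) :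
    lateCumFcast ω₂ lam β γ T (n + 1) s t z =
      ∫ u in Ioi (0 : ℝ), lateWeight s t u * kinAct ω₂ lam β γ T (n + 1) 0 u z := by
  unfold lateCumFcast
  rw [dif_pos (Nat.succ_pos n)]
  rfl

/-- `𝔊^{s,t}_{n+1}` is the kick average of `U^{s,t}_{n+1}`. [formal bookkeeping] -/
theorem heatReturnProfile_succ (ω₂ lam β γ T : ℝ) (n : ℕ) (s t : ℝ) :
    heatReturnProfile ω₂ lam β γ T (n + 1) s t = kickAvg ω₂ lam β γ T n (lateCumFcast ω₂ lam β γ T (n + 1) s t) := by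
  funext k
  unfold heatReturnProfile kickAvg
  rw [dif_pos (Nat.succ_pos n)]
  rfl

/-- `|min(r, a)| ≤ |a|` for `r ≥ 0`. [formal bookkeeping] -/
theorem abs_min_le_abs_of_nonneg {r : ℝ} (a : ℝ) (hr : 0 ≤ r) : |min r a| ≤ |a| := by
  rcases le_total r a with h | h
  · rw [min_eq_left h, abs_of_nonneg hr]; exact h.trans (le_abs_self a)
  · rw [min_eq_right h]

/-- The late weight is bounded on `[0,∞)`: `|ℓ_{s,t}(r)| ≤ |t| + 4|s|`. [formal bookkeeping] -/
theorem abs_lateWeight_le (s t : ℝ) {r : ℝ} (hr : 0 ≤ r) : |lateWeight s t r| ≤ |t| + 4 * |s| := by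
  unfold lateWeight
  have h1 := abs_le.1 (abs_min_le_abs_of_nonneg t hr)
  have h2 := abs_le.1 (abs_min_le_abs_of_nonneg s hr)
  have h3 := abs_le.1 (abs_min_le_abs_of_nonneg (2 * s) hr)
  rw [abs_mul, abs_two] at h3
  rw [abs_le]
  constructor <;> linarith [h1.1, h1.2, h2.1, h2.2, h3.1, h3.2]

/-- **The kick changes the energy by `(k² − p₀²)/2`**: `H(q, p[0 ↦ k]) = H(q,p) − p₀²/2 + k²/2`. [folklore] -/
theorem hamiltonian_kick_eq (P : OscillatorChain) {n : ℕ} (z : PhaseSpace (n + 1)) (k : ℝ) :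
    P.hamiltonian (n + 1) ((z.1, Function.update z.2 0 k) : PhaseSpace (n + 1)) =
      P.hamiltonian (n + 1) z - z.2 0 ^ 2 / 2 + k ^ 2 / 2 := by
  rw [hamiltonian_eq_kinetic_add_potential, hamiltonian_eq_kinetic_add_potential]
  have e : (fun i : Fin (n + 1) => Function.update z.2 0 k i ^ 2 / 2) =
      Function.update (fun i : Fin (n + 1) => z.2 i ^ 2 / 2) 0 (k ^ 2 / 2) := by
    funext i
    exact Function.apply_update (fun _ x => x ^ 2 / 2) z.2 0 k i
  have h1 : ∑ i : Fin (n + 1), Function.update z.2 0 k i ^ 2 / 2 =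
      k ^ 2 / 2 + ∑ i ∈ Finset.univ \ {0}, z.2 i ^ 2 / 2 := by
    rw [e]; exact Finset.sum_update_of_mem (Finset.mem_univ _) _ _
  have h2 : ∑ i : Fin (n + 1), z.2 i ^ 2 / 2 = z.2 0 ^ 2 / 2 + ∑ i ∈ Finset.univ \ {0}, z.2 i ^ 2 / 2 := by
    have h := Finset.sum_update_of_mem (Finset.mem_univ (0 : Fin (n + 1))) (fun i : Fin (n + 1) => z.2 i ^ 2 / 2) (z.2 0 ^ 2 / 2)
    rwa [Function.update_eq_self] at h
  simp only
  rw [h1, h2]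
  ring

/-- Measurability of the kick map `z ↦ (q, p[0 ↦ k])`. [folklore] -/
theorem measurable_kickMomentum (n : ℕ) (k : ℝ) :
    Measurable fun z : PhaseSpace (n + 1) => ((z.1, Function.update z.2 0 k) : PhaseSpace (n + 1)) :=
  (measurable_setMomentum n).comp measurable_prodMk_left

section LateCum

variable {ω₂ lam β γ : ℝ} {T : ℝ}

/-- `v_u = P_u θ_b` is flip-even: `v_u(−x) = v_u(x)` (`K_u(−x,·) = Π_* K_u(x,·)`, `transitionKernel_neg`). [folklore] -/
theorem kinAct_neg (hω : 0 < ω₂) (hl : 0 ≤ lam) (hβ : 0 ≤ β) (hγ : 0 ≤ γ) (T : ℝ) {N : ℕ} (b : Fin N) (u : ℝ) (x : PhaseSpace N) :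
    kinAct ω₂ lam β γ T N b u (-x) = kinAct ω₂ lam β γ T N b u x := by
  unfold kinAct
  rw [PhononMeanFreePath.transitionKernel_neg ω₂ lam β γ hω hl hβ hγ N T T u.toNNReal x,
    integral_map measurable_neg.aemeasurable (continuous_kinObs T b).stronglyMeasurable.aestronglyMeasurable]
  simp only [kinObs, Prod.snd_neg, Pi.neg_apply, neg_sq]

/-- `U^{s,t}_{n+1}` is flip-even. [this cell] -/
theorem lateCumFcast_neg (hω : 0 < ω₂) (hl : 0 ≤ lam) (hβ : 0 ≤ β) (hγ : 0 ≤ γ) (T : ℝ) (n : ℕ) (s t : ℝ) (z : PhaseSpace (n + 1)) :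
    lateCumFcast ω₂ lam β γ T (n + 1) s t (-z) = lateCumFcast ω₂ lam β γ T (n + 1) s t z := by
  rw [lateCumFcast_succ, lateCumFcast_succ]
  simp_rw [kinAct_neg hω hl hβ hγ T (0 : Fin (n + 1))]

/-- ★ **EVENNESS**: the heat-return curve is EVEN in `k` — it depends on the injected ENERGY `k²/2` only. [this cell] -/
theorem heatReturnProfile_neg (hω : 0 < ω₂) (hl : 0 ≤ lam) (hβ : 0 ≤ β) (hγ : 0 ≤ γ) (T : ℝ) (N : ℕ) (s t k : ℝ) :
    heatReturnProfile ω₂ lam β γ T N s t (-k) = heatReturnProfile ω₂ lam β γ T N s t k := by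
  rcases Nat.eq_zero_or_pos N with h0 | hN
  · subst h0; simp [heatReturnProfile]
  obtain ⟨n, rfl⟩ : ∃ n, N = n + 1 := ⟨N - 1, by omega⟩
  rw [heatReturnProfile_succ]
  exact kickAvg_neg (fun z => lateCumFcast_neg hω hl hβ hγ T n s t z) k

/-- `U^{s,t}_{n+1}` is strongly measurable. [folklore] -/
theorem stronglyMeasurable_lateCumFcast (hω : 0 < ω₂) (hl : 0 ≤ lam) (hβ : 0 ≤ β) (hγ : 0 ≤ γ) (T : ℝ) (n : ℕ) (s t : ℝ) :
    StronglyMeasurable (lateCumFcast ω₂ lam β γ T (n + 1) s t) := by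
  have h1 := pinnedChain_stronglyMeasurable_act_uncurry hω hl hβ hγ T T (N := n + 1)
    (continuous_kinObs T (0 : Fin (n + 1))).measurable
  have h2 : StronglyMeasurable fun q : ℝ × PhaseSpace (n + 1) => lateWeight s t q.1 :=
    ((continuous_lateWeight s t).measurable.comp measurable_fst).stronglyMeasurable
  have h3 := StronglyMeasurable.integral_prod_left' (μ := volume.restrict (Ioi (0 : ℝ))) (h2.mul h1)
  have e : lateCumFcast ω₂ lam β γ T (n + 1) s t =
      fun z => ∫ u in Ioi (0 : ℝ), lateWeight s t u * kinAct ω₂ lam β γ T (n + 1) 0 u z :=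
    funext (lateCumFcast_succ ω₂ lam β γ T n s t)
  rw [e]
  exact h3

/-- **Pointwise bound**: `|U^{s,t}_{n+1}(z)| ≤ (|t| + 4|s|)·K(2/ϑ+T)/c · e^{ϑH(z)}`. [folklore] -/
theorem abs_lateCumFcast_le (hω : 0 < ω₂) (hl : 0 ≤ lam) (hβ : 0 < β) (hγ : 0 < γ) (hT : 0 < T) {n : ℕ} {ϑ K c : ℝ}
    (hϑ0 : 0 < ϑ) (hb : ∀ (z : PhaseSpace (n + 1)) (t : ℝ≥0) (f : PhaseSpace (n + 1) → ℝ), Continuous f → ∀ C : ℝ, 0 ≤ C →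
      (∀ y, |f y| ≤ C * Real.exp (ϑ * (pinnedChain ω₂ lam β γ).hamiltonian (n + 1) y)) →
      |(∫ y, f y ∂((pinnedChain ω₂ lam β γ).transitionKernel (n + 1) T T t z)) -
          ∫ y, f y ∂((pinnedChain ω₂ lam β γ).gibbsMeasure (n + 1) T)| ≤
        K * C * Real.exp (ϑ * (pinnedChain ω₂ lam β γ).hamiltonian (n + 1) z) * Real.exp (-c * t)) (hc : 0 < c)
    (s t : ℝ) (z : PhaseSpace (n + 1)) :
    |lateCumFcast ω₂ lam β γ T (n + 1) s t z| ≤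
      (|t| + 4 * |s|) * (K * (2 / ϑ + T)) / c * Real.exp (ϑ * (pinnedChain ω₂ lam β γ).hamiltonian (n + 1) z) := by
  rw [lateCumFcast_succ]
  obtain ⟨-, hpt⟩ := kinAct_integrableOn hω hl hβ hγ hT hϑ0 hb hc (0 : Fin (n + 1)) z
  set E := Real.exp (ϑ * (pinnedChain ω₂ lam β γ).hamiltonian (n + 1) z) with hE
  set W := |t| + 4 * |s| with hWdef
  have hdecay : IntegrableOn (fun u : ℝ => W * (K * (2 / ϑ + T)) * E * Real.exp (-c * u)) (Ioi 0) :=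
    (exp_neg_integrableOn_Ioi 0 hc).const_mul _
  have hbd : ∀ᵐ u ∂(volume.restrict (Ioi (0 : ℝ))),
      ‖lateWeight s t u * kinAct ω₂ lam β γ T (n + 1) 0 u z‖ ≤ W * (K * (2 / ϑ + T)) * E * Real.exp (-c * u) :=
    (ae_restrict_iff' measurableSet_Ioi).2 (Eventually.of_forall fun u hu => by
      rw [norm_mul, Real.norm_eq_abs, Real.norm_eq_abs]
      have h1 := hpt u (le_of_lt (show (0:ℝ) < u from hu))
      have h2 := abs_lateWeight_le s t (le_of_lt (show (0:ℝ) < u from hu))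
      have h0 : 0 ≤ K * (2 / ϑ + T) * E * Real.exp (-c * u) := (abs_nonneg _).trans h1
      calc |lateWeight s t u| * |kinAct ω₂ lam β γ T (n + 1) 0 u z|
          ≤ W * (K * (2 / ϑ + T) * E * Real.exp (-c * u)) := mul_le_mul h2 h1 (abs_nonneg _) ((abs_nonneg _).trans h2)
        _ = W * (K * (2 / ϑ + T)) * E * Real.exp (-c * u) := by ring)
  have h := norm_integral_le_of_norm_le hdecay hbd
  rw [Real.norm_eq_abs, integral_const_mul, integral_exp_neg_mul_Ioi' hc] at h
  calc _ ≤ W * (K * (2 / ϑ + T)) * E * (1 / c) := h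
    _ = W * (K * (2 / ϑ + T)) / c * E := by ring

/-- **`U^{s,t}_{n+1} ∈ L²(μ_T)` and `θ₀·U^{s,t}_{n+1} ∈ L¹(μ_T)`.** [folklore] -/
theorem lateCumFcast_sq_facts (hω : 0 < ω₂) (hl : 0 ≤ lam) (hβ : 0 < β) (hγ : 0 < γ) (hT : 0 < T) (n : ℕ) (s t : ℝ) :
    Integrable (fun z => lateCumFcast ω₂ lam β γ T (n + 1) s t z ^ 2) ((pinnedChain ω₂ lam β γ).gibbsMeasure (n + 1) T) ∧
    Integrable (fun z : PhaseSpace (n + 1) => (z.2 0 ^ 2 - T) * lateCumFcast ω₂ lam β γ T (n + 1) s t z)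
      ((pinnedChain ω₂ lam β γ).gibbsMeasure (n + 1) T) := by
  obtain ⟨hϑ0, h2ϑ, hϑ1⟩ := weight_facts hT
  obtain ⟨K, c, hK0, hc, hb⟩ := harrisBound_exists hω hl hβ hγ (Nat.succ_pos n) hT hϑ0 hϑ1
  have hUm := stronglyMeasurable_lateCumFcast hω hl hβ.le hγ.le T n s t
  have hU2 := (pinnedChain_integral_sq_act_le_of_stronglyMeasurable hω hl hβ hγ (Nat.succ_pos n) hT hϑ0 h2ϑ hUm
    (abs_lateCumFcast_le hω hl hβ hγ hT hϑ0 hb hc s t) 0).1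
  obtain ⟨hθm, hθ2⟩ := kinObs_sq_facts hω hl hβ hγ (Nat.succ_pos n) hT (0 : Fin (n + 1))
  refine ⟨hU2, ?_⟩
  exact integrable_mul_of_integrable_sq hθm.aestronglyMeasurable hUm.aestronglyMeasurable hθ2 hU2

end LateCum

end Summit.AtomisticToContinuum.FouriersLaw.Theorems.BoundedResponse.HeatSpreading

end
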